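import Summits.ABC.IUTFork.Joshi.ArithHolStructureTiltComplete
import HarnessLib

/-!
# `𝒪_{K♭}/ϖ♭ ≃+* 𝒪_K/p` — the defining identification of the tilt ([Scholze 2012, Lem. 3.4]) on Mathlib's `PreTilt`
# (MODEL / SUPPLY over p442777/p447287; abc-iut block E, seat E-t10 gen 4)

[J-I] = Joshi, arXiv:2106.11452v4 §3.3 p.9 l.31–33 introduces the tilt `K♭` by citing [Scholze 2012, Lem. 3.4], whose content is the
identification `𝒪_{K♭}/ϖ♭ = 𝒪_K/p` (with `𝒪_{K♭} = lim_Φ 𝒪_K/p`, `ϖ♭ = (p, p^{1/p}, …) mod p`). On Mathlib's `PreTilt 𝒪_K p` (the carrier of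
p431050's `ATS1.tilt`), with p442777's `varpi` and p447287's `coeff_zero_eq_zero_iff`, we PROVE, hypothesis-free, for every untilt `K`:
* `frobenius_modP_surjective`: Frobenius is ONTO `𝒪_K/p` (`K` algebraically closed: `p`-th roots exist and are integral);
* `coeff_zero_surjective`: the projection `(𝒪_K/p)^perf → 𝒪_K/p`, `f ↦ f_0`, is onto (Mathlib `Perfection.coeff_surjective`);
* `coeff_zero_eq_zero_iff_varpi_dvd`: its kernel is EXACTLY `(ϖ♭)` (`f_0 = 0 ⟺ |f|_♭ ≤ ‖p‖ = |ϖ♭|_♭ ⟺ ϖ♭ ∣ f`, by p446090's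
  `dvd_of_valInt_le`); `ker_coeff_zero`;
* **`modVarpiEquiv U : PreTilt (int U) p ⧸ (ϖ♭) ≃+* ModP (int U) p`**, i.e. `𝒪_{K♭}/ϖ♭ ≅ 𝒪_K/p`. CONSTRUCTED.
All [folklore]; no claim of Joshi's used or asserted; no `Prop` hypothesis, instance, notation or FACT-LIST row. No side taken on
[IUTchIII] Cor. 3.12 or on any author. bears_on: LADDER-ABC:A2.E.
-/

noncomputable section

open scoped NNReal

namespace Summit.ABC.IUTFork.Joshi.ATS1

open Summit.ABC.IUTFork.Joshi

variable {p : ℕ} [Fact p.Prime]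

namespace TiltModel

section Integral

variable (U : Untilt p) [Fact (¬ IsUnit ((p : ℕ) : int U))]

/-- **Frobenius is onto `𝒪_K/p`**: every `a ∈ 𝒪_K` is a `p`-th power mod `p` — indeed exactly, `K` being algebraically closed and
`p`-th roots of integral elements integral. PROVED. [folklore] -/
theorem frobenius_modP_surjective : Function.Surjective (frobenius (ModP (int U) p) p) := fun x => by
  obtain ⟨a, rfl⟩ := Ideal.Quotient.mk_surjective x
  have hp : p.Prime := Fact.out
  obtain ⟨b, hb⟩ := IsAlgClosed.exists_pow_nat_eq (a : U.K) hp.pos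
  have hb1 : ‖b‖ ≤ 1 := by
    have h := norm_coe_le_one a
    rw [← hb, norm_pow] at h
    exact (pow_le_one_iff_of_nonneg (norm_nonneg _) hp.ne_zero).1 h
  refine ⟨Ideal.Quotient.mk _ ⟨b, (mem_int_iff U).2 hb1⟩, ?_⟩
  rw [frobenius_def, ← map_pow]
  congr 1
  exact Subtype.ext (by rw [SubmonoidClass.coe_pow]; exact hb)

/-- **`f ↦ f_0`, `(𝒪_K/p)^perf → 𝒪_K/p`, is onto** (Mathlib `Perfection.coeff_surjective`, Frobenius being onto `𝒪_K/p`). [folklore] -/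
theorem coeff_zero_surjective : Function.Surjective (PreTilt.coeff 0 : PreTilt (int U) p → ModP (int U) p) :=
  Perfection.coeff_surjective (frobenius_modP_surjective U) 0

variable [IsAdicComplete (Ideal.span {((p : ℕ) : int U)}) (int U)]

/-- **`f_0 = 0 ⟺ ϖ♭ ∣ f`** in `𝒪_{K♭} = (𝒪_K/p)^perf`: `f_0 = 0 ⟺ |f|_♭ ≤ ‖p‖ = |ϖ♭|_♭` (p447287 `coeff_zero_eq_zero_iff`, p442777
`valInt_varpi`) `⟺ ϖ♭ ∣ f` (p446090 `dvd_of_valInt_le`). PROVED. [folklore] -/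
theorem coeff_zero_eq_zero_iff_varpi_dvd (f : PreTilt (int U) p) : PreTilt.coeff 0 f = 0 ↔ varpi U ∣ f := by
  rw [coeff_zero_eq_zero_iff, ← valInt_varpi U]
  refine ⟨fun h => dvd_of_valInt_le U (varpi_ne_zero U) h, fun ⟨g, hg⟩ => ?_⟩
  rw [hg, map_mul]
  exact mul_le_of_le_one_right zero_le (valInt_le_one U g)

/-- `ker (f ↦ f_0) = (ϖ♭)`. [folklore] -/
theorem ker_coeff_zero : RingHom.ker (PreTilt.coeff 0 : PreTilt (int U) p →+* ModP (int U) p) = Ideal.span {varpi U} := by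
  ext f
  rw [RingHom.mem_ker, coeff_zero_eq_zero_iff_varpi_dvd, Ideal.mem_span_singleton]

/-- **`𝒪_{K♭}/ϖ♭ ≃+* 𝒪_K/p`** ([Scholze 2012, Lem. 3.4]: `𝒪_{K♭}/ϖ♭ = 𝒪_K/ϖ` with `ϖ = p`) on Mathlib's `PreTilt 𝒪_K p`: the first
projection of `lim_Φ 𝒪_K/p` modulo its kernel `(ϖ♭)`. CONSTRUCTED, hypothesis-free. [folklore] -/
def modVarpiEquiv : (PreTilt (int U) p ⧸ Ideal.span {varpi U}) ≃+* ModP (int U) p :=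
  (Ideal.quotEquivOfEq (ker_coeff_zero U).symm).trans (RingHom.quotientKerEquivOfSurjective (coeff_zero_surjective U))

/-- `modVarpiEquiv` is induced by `f ↦ f_0`. [folklore] -/
theorem modVarpiEquiv_mk (f : PreTilt (int U) p) :
    modVarpiEquiv U (Ideal.Quotient.mk _ f) = PreTilt.coeff 0 f := rfl

/-- … in particular the residue of `ϖ♭` is `0` and that of a reduced tower `ofSeq x` is `x_0 mod p`. [folklore] -/
theorem coeff_zero_varpi : PreTilt.coeff 0 (varpi U) = 0 :=
  (coeff_zero_eq_zero_iff_varpi_dvd U _).2 (dvd_refl _)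

end Integral

/-! ## Hypothesis-free packaging on `ATS1.tilt U`'s ring of definition -/

/-- **[Scholze 2012, Lem. 3.4] for every untilt, no hypotheses**: with the instances supplied by p442777 (`isAdicComplete_int`) the ring
`𝒪_{K♭} = PreTilt 𝒪_K p` underlying `ATS1.tilt U = Frac 𝒪_{K♭}` satisfies `𝒪_{K♭}/ϖ♭ ≃+* 𝒪_K/p`. [folklore] -/
def modVarpiEquivTilt (U : Untilt p) :
    haveI : Fact (¬ IsUnit ((p : ℕ) : int U)) := ⟨not_isUnit_p U⟩
    haveI : IsAdicComplete (Ideal.span {((p : ℕ) : int U)}) (int U) := isAdicComplete_int U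
    (PreTilt (int U) p ⧸ Ideal.span {varpi U}) ≃+* ModP (int U) p :=
  haveI : Fact (¬ IsUnit ((p : ℕ) : int U)) := ⟨not_isUnit_p U⟩
  haveI : IsAdicComplete (Ideal.span {((p : ℕ) : int U)}) (int U) := isAdicComplete_int U
  modVarpiEquiv U

end TiltModel

end Summit.ABC.IUTFork.Joshi.ATS1

end
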